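import Summits.AtomisticToContinuum.Crystallization.Theorems.ChargedEnergyGapConvexPiecesA

/-!
# NODE 80-PILOT «ConvexPieces» — part 2 of 2 (sequel of `…ChargedEnergyGapConvexPiecesA`, whose module docstring describes the node; lens-3 g79/g80, item 14231)

Split for the 400-line cap by the landing lane (hand-2 g38) at §2 ‖ §3 as approved by critic row 1437 (A).  This part: §3 the primed statements of NODES 75/76
(one binder `(∀ i, IsConvexPieces (2 * ϱχ) (D i))` after the invariance binder), the weakenings «unprimed ⇒ primed», and the glue of NODE 76 re-proved
parametrically.  Same namespace and opens; all FQNs unchanged; bodies verbatim.  0 sorry; standard axioms.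
-/

noncomputable section

open scoped Classical
open Literature.MathematicalPhysics.StatisticalMechanics Literature.Geometry.DiscreteGeometry
open Summit.AtomisticToContinuum.Crystallization.Theses.PricedLinkCensus
open Summit.AtomisticToContinuum.Crystallization.Theorems.ChargedEnergyGapNegative

namespace Summit.AtomisticToContinuum.Crystallization.Theorems.ChargedEnergyGapChartDial

/-! ## §3 The primed statements of NODES 75/76 — one binder `(∀ i, IsConvexPieces (2 * ϱχ) (D i))` after the invariance binder -/

section Primed

/-- (G)′ **THE F-LEDGER OVER CONVEX-PIECE CUT LISTS**: tree `FLedgerQ` (…SquareSumA) verbatim with the admissibility binder inserted. -/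
def FLedgerQ' (cls : Set E3 → Prop) (F : (Fin 3 × Bool → ℝ) → ℝ) (s lam ℓ τ ϱ ϱχ r₁ r₂ : ℝ) (ρlo ρhi c_T cχ : ℝ) : Prop :=
  ∃ c_H : ℝ, 0 ≤ c_H ∧ ∀ (P : PeriodicConfiguration 3) (C X : Set E3) (m : ℕ) (D : Fin m → Set E3) (σ : Fin m → Bool),
    IsSeparatedRef s P → IsLabelledRef lam ℓ P → cls P.points → IsForceFree P → IsSiteStressFree P →
    IsInvariantSet P C → IsInvariantSet P X → (∀ i, IsInvariantSet P (D i)) → (∀ i, IsConvexPieces (2 * ϱχ) (D i)) →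
    IsFramedOct P r₁ r₂ ρlo ρhi →
      fShellL ϱχ D σ F r₁ r₂ τ P X ϱ C ≤
        c_T * shellMassL ϱχ D σ P X ϱ C + cχ * transMassL ϱχ D σ P X ϱ C + c_H * (pricedNearCountL ϱχ D σ P X ϱ C : ℝ)

/-- ★★ (G_T)′ **THE ROOF LEDGER OVER CONVEX-PIECE CUT LISTS** — the repaired residual leaf of NODE 75 (the tree's (G_T) `RoofLedgerQ` is
false-leaning as typed, RIDGE-79).  [residual · UNDECIDED → TRUE-leaning: g76 worst `0.859` (margin `1.16`) over the now-admissible periodic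
half-space family · INSTRUMENTABLE · ATTACKABLE-L; door [SEMICONCAVE] as for (G_T)] -/
def RoofLedgerQ' (cls : Set E3 → Prop) (s lam ℓ τ ϱ ϱχ r₁ r₂ : ℝ) (ρlo ρhi c_T cχ : ℝ) : Prop :=
  FLedgerQ' cls (roofVal T75) s lam ℓ τ ϱ ϱχ r₁ r₂ ρlo ρhi c_T cχ

/-- (D)′ deep tame vanishing over convex-piece cut lists (tree `DeepTameVanishingQ` + the binder; PROVED below from (Z₀) via the tree). -/
def DeepTameVanishingQ' (cls : Set E3 → Prop) (r_f dstar : ℝ) (s lam ℓ τ ϱ ϱχ r₁ r₂ ρlo ρhi : ℝ) : Prop :=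
  ∀ (P : PeriodicConfiguration 3) (C X : Set E3) (m : ℕ) (D : Fin m → Set E3) (σ : Fin m → Bool),
    IsSeparatedRef s P → IsLabelledRef lam ℓ P → cls P.points → IsForceFree P → IsSiteStressFree P →
    IsInvariantSet P C → IsInvariantSet P X → (∀ i, IsInvariantSet P (D i)) → (∀ i, IsConvexPieces (2 * ϱχ) (D i)) →
    IsFramedOct P r₁ r₂ ρlo ρhi →
    ∀ y ∈ P.points, ∀ z ∈ P.points, r₁ < dist y z → dist y z ≤ r₂ →
      OctClean P r₁ X y z → ¬OctPlateau P r₁ (siteW ϱχ D σ X ϱ C) y z →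
      OctChiFree ϱχ D P r₁ y z → OctTame r_f C P r₁ y z → OctDeep dstar C P r₁ y z →
        frameVal (roofVal T75) τ (siteW ϱχ D σ X ϱ C) P r₁ y z ≤ 0

/-- (S)′ shallow tame charge over convex-piece cut lists (tree `ShallowTameChargeQ` + the binder; PROVED below from (S♯) ∧ (I₃₆)). -/
def ShallowTameChargeQ' (cls : Set E3 → Prop) (r_f dstar κ : ℝ) (s lam ℓ τ ϱ ϱχ r₁ r₂ ρlo ρhi : ℝ) : Prop :=
  ∀ (P : PeriodicConfiguration 3) (C X : Set E3) (m : ℕ) (D : Fin m → Set E3) (σ : Fin m → Bool),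
    IsSeparatedRef s P → IsLabelledRef lam ℓ P → cls P.points → IsForceFree P → IsSiteStressFree P →
    IsInvariantSet P C → IsInvariantSet P X → (∀ i, IsInvariantSet P (D i)) → (∀ i, IsConvexPieces (2 * ϱχ) (D i)) →
    IsFramedOct P r₁ r₂ ρlo ρhi →
      fShellSel ϱχ D σ (fun y z => (OctChiFree ϱχ D P r₁ y z ∧ OctTame r_f C P r₁ y z) ∧ ¬OctDeep dstar C P r₁ y z)
          (roofVal T75) r₁ r₂ τ P X ϱ C ≤
        6 * κ * sVertMassL ϱχ D σ r_f dstar P C X ϱ r₁ r₂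

/-- ★★★ (KX)′ **THE CREASE-OR-TRANSITION LEDGER OVER CONVEX-PIECE CUT LISTS** — the repaired residual of NODE 76: tree
`CreaseTransitionLedgerQ` verbatim with `(∀ i, IsConvexPieces (2 * ϱχ) (D i))` inserted after the invariance binder.  Every χ-cut entry is
a `Λ_P`-periodic union of closed convex pieces `≥ 2ϱχ` apart, so inside its band `dist(·, Dᵢ) < ϱχ` the distance is to ONE convex piece:
no in-band ridge, `χ_σ ∈ C¹·¹`, level-set curvature `≤ 2/ϱχ` (single-feature curvature: free, g76).  The g76 family (periodic half-space
cuts, `m ∈ {1, 2}`, `σ ∈ {tt, tf, ff, t, f}`) is admissible (§2 (i)) and is the worst found: cost/budget `0.859` at `L = 118`, `c = 80.7`, tt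
(margin `1.16`); the RIDGE-79 kills (`{|s| ≥ c}` as one entry, cylinder complements) are excluded (§2 (iii)).
[residual · NEW · UNDECIDED → TRUE-leaning (margin `1.16`) · INSTRUMENTABLE · ATTACKABLE-L; door [BALLS]: the transport of NODES 78R/79
(`CreaseBallQ` / `BallMatchingQ`) re-issued with this binder] -/
def CreaseTransitionLedgerQ' (cls : Set E3 → Prop) (r_f dstar κ : ℝ) (s lam ℓ τ ϱ ϱχ r₁ r₂ ρlo ρhi c_T cχ : ℝ) : Prop :=
  ∃ c_H : ℝ, 0 ≤ c_H ∧ ∀ (P : PeriodicConfiguration 3) (C X : Set E3) (m : ℕ) (D : Fin m → Set E3) (σ : Fin m → Bool),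
    IsSeparatedRef s P → IsLabelledRef lam ℓ P → cls P.points → IsForceFree P → IsSiteStressFree P →
    IsInvariantSet P C → IsInvariantSet P X → (∀ i, IsInvariantSet P (D i)) → (∀ i, IsConvexPieces (2 * ϱχ) (D i)) →
    IsFramedOct P r₁ r₂ ρlo ρhi →
      fShellSel ϱχ D σ (fun y z => ¬(OctChiFree ϱχ D P r₁ y z ∧ OctTame r_f C P r₁ y z)) (roofVal T75) r₁ r₂ τ P X ϱ C ≤
        c_T * shellMassL ϱχ D σ P X ϱ C - 6 * κ * sVertMassL ϱχ D σ r_f dstar P C X ϱ r₁ r₂ + cχ * transMassL ϱχ D σ P X ϱ C +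
          c_H * (pricedNearCountL ϱχ D σ P X ϱ C : ℝ)

/-! ### Weakenings: every unprimed `∀`-list statement implies its primed form (one hypothesis more). -/

/-- `fLedgerQ'_of_fLedgerQ` (docstring added by the landing lane; see the module docstring). [formal bookkeeping] -/
theorem fLedgerQ'_of_fLedgerQ {cls : Set E3 → Prop} {F : (Fin 3 × Bool → ℝ) → ℝ} {s lam ℓ τ ϱ ϱχ r₁ r₂ ρlo ρhi c_T cχ : ℝ}
    (h : FLedgerQ cls F s lam ℓ τ ϱ ϱχ r₁ r₂ ρlo ρhi c_T cχ) : FLedgerQ' cls F s lam ℓ τ ϱ ϱχ r₁ r₂ ρlo ρhi c_T cχ := by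
  obtain ⟨c_H, hc, h⟩ := h
  exact ⟨c_H, hc, fun P C X m D σ h1 h2 hcl h3 h4 h6 h7 h11 _ hFr => h P C X m D σ h1 h2 hcl h3 h4 h6 h7 h11 hFr⟩

/-- `roofLedgerQ'_of_roofLedgerQ` (docstring added by the landing lane; see the module docstring). [formal bookkeeping] -/
theorem roofLedgerQ'_of_roofLedgerQ {cls : Set E3 → Prop} {s lam ℓ τ ϱ ϱχ r₁ r₂ ρlo ρhi c_T cχ : ℝ}
    (h : RoofLedgerQ cls s lam ℓ τ ϱ ϱχ r₁ r₂ ρlo ρhi c_T cχ) : RoofLedgerQ' cls s lam ℓ τ ϱ ϱχ r₁ r₂ ρlo ρhi c_T cχ :=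
  fLedgerQ'_of_fLedgerQ h

/-- `deepTameVanishingQ'_of_deepTameVanishingQ` (docstring added by the landing lane; see the module docstring). [formal bookkeeping] -/
theorem deepTameVanishingQ'_of_deepTameVanishingQ {cls : Set E3 → Prop} {r_f dstar s lam ℓ τ ϱ ϱχ r₁ r₂ ρlo ρhi : ℝ}
    (h : DeepTameVanishingQ cls r_f dstar s lam ℓ τ ϱ ϱχ r₁ r₂ ρlo ρhi) :
    DeepTameVanishingQ' cls r_f dstar s lam ℓ τ ϱ ϱχ r₁ r₂ ρlo ρhi :=
  fun P C X m D σ h1 h2 hcl h3 h4 h6 h7 h11 _ hFr => h P C X m D σ h1 h2 hcl h3 h4 h6 h7 h11 hFr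

/-- `shallowTameChargeQ'_of_shallowTameChargeQ` (docstring added by the landing lane; see the module docstring). [formal bookkeeping] -/
theorem shallowTameChargeQ'_of_shallowTameChargeQ {cls : Set E3 → Prop} {r_f dstar κ s lam ℓ τ ϱ ϱχ r₁ r₂ ρlo ρhi : ℝ}
    (h : ShallowTameChargeQ cls r_f dstar κ s lam ℓ τ ϱ ϱχ r₁ r₂ ρlo ρhi) :
    ShallowTameChargeQ' cls r_f dstar κ s lam ℓ τ ϱ ϱχ r₁ r₂ ρlo ρhi :=
  fun P C X m D σ h1 h2 hcl h3 h4 h6 h7 h11 _ hFr => h P C X m D σ h1 h2 hcl h3 h4 h6 h7 h11 hFr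

/-- `creaseTransitionLedgerQ'_of_creaseTransitionLedgerQ` (docstring added by the landing lane; see the module docstring). [formal bookkeeping] -/
theorem creaseTransitionLedgerQ'_of_creaseTransitionLedgerQ {cls : Set E3 → Prop}
    {r_f dstar κ s lam ℓ τ ϱ ϱχ r₁ r₂ ρlo ρhi c_T cχ : ℝ}
    (h : CreaseTransitionLedgerQ cls r_f dstar κ s lam ℓ τ ϱ ϱχ r₁ r₂ ρlo ρhi c_T cχ) :
    CreaseTransitionLedgerQ' cls r_f dstar κ s lam ℓ τ ϱ ϱχ r₁ r₂ ρlo ρhi c_T cχ := by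
  obtain ⟨c_H, hc, h⟩ := h
  exact ⟨c_H, hc, fun P C X m D σ h1 h2 hcl h3 h4 h6 h7 h11 _ hFr => h P C X m D σ h1 h2 hcl h3 h4 h6 h7 h11 hFr⟩

/-! ### The glue of NODE 76, re-proved parametrically over the admissible lists -/

/-- ★★★ **GLUE (PROVED)**: (D)′ ∧ (S)′ ∧ (KX)′ ⟹ (G_T)′ — the tree proof of `roofLedgerQ_of_classes` with the admissibility binder threaded
(the three classes partition the clean non-plateau shell octahedra of each admissible configuration; the budgets add up exactly). -/
theorem roofLedgerQ'_of_classes' {cls : Set E3 → Prop} {r_f dstar κ s lam ℓ τ ϱ ϱχ r₁ r₂ ρlo ρhi c_T cχ : ℝ} (hs : 0 < s)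
    (hD : DeepTameVanishingQ' cls r_f dstar s lam ℓ τ ϱ ϱχ r₁ r₂ ρlo ρhi)
    (hS : ShallowTameChargeQ' cls r_f dstar κ s lam ℓ τ ϱ ϱχ r₁ r₂ ρlo ρhi)
    (hKX : CreaseTransitionLedgerQ' cls r_f dstar κ s lam ℓ τ ϱ ϱχ r₁ r₂ ρlo ρhi c_T cχ) :
    RoofLedgerQ' cls s lam ℓ τ ϱ ϱχ r₁ r₂ ρlo ρhi c_T cχ := by
  obtain ⟨cH, hcH, hKX⟩ := hKX
  refine ⟨cH, hcH, fun P C X m D σ h1 h2 hcl h3 h4 h6 h7 h11 hcv hFr => ?_⟩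
  have eS := hS P C X m D σ h1 h2 hcl h3 h4 h6 h7 h11 hcv hFr
  have eKX := hKX P C X m D σ h1 h2 hcl h3 h4 h6 h7 h11 hcv hFr
  have s1 := fShellSel_split (ϱχ := ϱχ) (D := D) (σ := σ) (π := fun _ _ => True)
    (π₁ := fun y z => ¬(OctChiFree ϱχ D P r₁ y z ∧ OctTame r_f C P r₁ y z))
    (π₂ := fun y z => OctChiFree ϱχ D P r₁ y z ∧ OctTame r_f C P r₁ y z) h1 hs
    (fun y z => by simpa using (em (OctChiFree ϱχ D P r₁ y z ∧ OctTame r_f C P r₁ y z)).symm) (fun y z h => h.1 h.2)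
    (roofVal T75) r₁ r₂ τ X ϱ C
  have s2 := fShellSel_split (ϱχ := ϱχ) (D := D) (σ := σ) (π := fun y z => OctChiFree ϱχ D P r₁ y z ∧ OctTame r_f C P r₁ y z)
    (π₁ := fun y z => (OctChiFree ϱχ D P r₁ y z ∧ OctTame r_f C P r₁ y z) ∧ ¬OctDeep dstar C P r₁ y z)
    (π₂ := fun y z => (OctChiFree ϱχ D P r₁ y z ∧ OctTame r_f C P r₁ y z) ∧ OctDeep dstar C P r₁ y z) h1 hs
    (fun y z => by constructor
                   · intro h; by_cases hd : OctDeep dstar C P r₁ y z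
                     · exact Or.inr ⟨h, hd⟩
                     · exact Or.inl ⟨h, hd⟩
                   · rintro (h | h) <;> exact h.1)
    (fun y z h => h.1.2 h.2.2) (roofVal T75) r₁ r₂ τ X ϱ C
  have eD : fShellSel ϱχ D σ (fun y z => (OctChiFree ϱχ D P r₁ y z ∧ OctTame r_f C P r₁ y z) ∧ OctDeep dstar C P r₁ y z)
      (roofVal T75) r₁ r₂ τ P X ϱ C ≤ 0 :=
    fShellSel_nonpos h1 hs fun y hy z hz hd1 hd2 hc hp hπ =>
      hD P C X m D σ h1 h2 hcl h3 h4 h6 h7 h11 hcv hFr y (P.mem_points_of_mem_motif hy) z hz hd1 hd2 hc hp hπ.1.1 hπ.1.2 hπ.2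
  show fShellL ϱχ D σ (roofVal T75) r₁ r₂ τ P X ϱ C ≤ _
  rw [fShellL_eq_fShellSel, s1, s2]
  linarith

/-- ★★★ **GLUE WITH THE BRIDGES (PROVED)**: (Z₀) ∧ (S♯) ∧ (I₃₆) ∧ (KX)′ ⟹ (G_T)′ — the D-free cell-LP leaves (Z₀) `SixFeetZeroConeQ`, (S♯)
`SixFeetShallowCapQ` and the accounting leaf (I₃₆) `SVertexIncidenceQ` (true for every list) give (D) and (S) for ALL lists by the tree, hence
(D)′ and (S)′; only the residual is primed. -/
theorem roofLedgerQ'_of_cover' {cls : Set E3 → Prop} {r_f dstar κ s lam ℓ τ ϱ ϱχ r₁ r₂ ρlo ρhi c_T cχ : ℝ}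
    (hs : 0 < s) (hκ : 0 ≤ κ) (hϱχ : 0 < ϱχ) (hr₁ : 0 ≤ r₁) (hsmall : 2 * (r₁ + r₂) < ϱχ / 2) (hlo : 0 < ρlo)
    (hZ : SixFeetZeroConeQ ρlo ρhi r_f dstar ϱ) (hCap : SixFeetShallowCapQ ρlo ρhi r_f dstar ϱ τ κ)
    (hI : SVertexIncidenceQ cls r_f dstar 36 s lam ℓ ϱ ϱχ r₁ r₂)
    (hKX : CreaseTransitionLedgerQ' cls r_f dstar κ s lam ℓ τ ϱ ϱχ r₁ r₂ ρlo ρhi c_T cχ) :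
    RoofLedgerQ' cls s lam ℓ τ ϱ ϱχ r₁ r₂ ρlo ρhi c_T cχ :=
  roofLedgerQ'_of_classes' hs (deepTameVanishingQ'_of_deepTameVanishingQ (deepTameVanishing_of_sixFeet hϱχ hr₁ hsmall hlo hZ))
    (shallowTameChargeQ'_of_shallowTameChargeQ (shallowTameCharge_of_cap hs hκ hϱχ hr₁ hsmall hlo hCap hI)) hKX

/-- ★★★ **NODE 76′ AT THE DESIGNATE (PROVED)**: with `r_f = 20`, `d⋆ = 106`, `κ = c_T/60`, `N_I = 36`, `ϱχ = 80` (so the admissibility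
constant reads `2 * 80`): (Z₀) ∧ (S♯) ∧ (I₃₆) ∧ (KX)′ ⟹ (G_T)′ `RoofLedgerQ' cls₀ (3/5) (1/3) 3 (3/100) 160 80 (6/5) (3/2) (679/1000) (691/1000)
(1/60000000) (1/2000000)`. -/
theorem roofLedgerQ'_designate_of_cover'
    (hZ : SixFeetZeroConeQ (679 / 1000) (691 / 1000) 20 106 160)
    (hCap : SixFeetShallowCapQ (679 / 1000) (691 / 1000) 20 106 160 (3 / 100) (1 / 3600000000))
    (hI : SVertexIncidenceQ cls₀ 20 106 36 (3 / 5) (1 / 3) 3 160 80 (6 / 5) (3 / 2))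
    (hKX : CreaseTransitionLedgerQ' cls₀ 20 106 (1 / 3600000000) (3 / 5) (1 / 3) 3 (3 / 100) 160 80 (6 / 5) (3 / 2) (679 / 1000)
      (691 / 1000) (1 / 60000000) (1 / 2000000)) :
    RoofLedgerQ' cls₀ (3 / 5) (1 / 3) 3 (3 / 100) 160 80 (6 / 5) (3 / 2) (679 / 1000) (691 / 1000) (1 / 60000000) (1 / 2000000) :=
  roofLedgerQ'_of_cover' (by norm_num) (by norm_num) (by norm_num) (by norm_num) (by norm_num) (by norm_num) hZ hCap hI hKX

/-- The admissible configurations of §2 are what (KX)′ / (G_T)′ quantify over: e.g. the g76 two-entry slab list in a supercell whose normal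
period is `400` is admitted by the binder of the designate statements (`2 * 80`-separated convex pieces, `Λ_P`-invariant). -/
example (P : PeriodicConfiguration 3) (hP : ∀ g ∈ P.lattice, ∃ n : ℤ, g 0 = n * 400) :
    (∀ i, IsInvariantSet P (g76List 400 (807 / 10) i)) ∧ ∀ i, IsConvexPieces (2 * 80) (g76List 400 (807 / 10) i) :=
  ⟨isInvariantSet_g76List P hP, isConvexPieces_g76List (by norm_num) (by norm_num)⟩

end Primed

end Summit.AtomisticToContinuum.Crystallization.Theorems.ChargedEnergyGapChartDial

end
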